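import Summits.NavierStokesRegularity.NavierStokesRegularity.Theses.QuantisedSymmetry
import Summits.NavierStokesRegularity.NavierStokesRegularity.Theorems.QuantisedSymmetryPolyhedralTruncationBridge
import Summits.NavierStokesRegularity.NavierStokesRegularity.Theorems.QuantisedSymmetryLiouvilleKillsProfile
import Summits.NavierStokesRegularity.NavierStokesRegularity.Theorems.QuantisedSymmetryPolyhedralDssProfileExistsDominatesBlowupProfile
import HarnessLib

/-!
# Strategist sketch s19-g4 (independent census, family `s`) for crux
`QuantisedSymmetry.PolyhedralDssProfileExists` (stmt-NavierStokesRegularity-1404).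

Typed record of the census attempts (no `sorry`):

* `crux_decides` — §0: the crux ALONE proves `¬ NavierStokesRegularity` from landed theorems
  (`closes` + `quantisedSymmetry_polyhedralTruncationBridge_proof` + `ClayUniqueness_holds`), i.e. it is
  summit-deciding on the negative side.
* `PolyhedralTypeILiouvilleFails` (E_G) — §1: the weakest typed consequence of the crux that is NOT
  (by any landed theorem) summit-deciding: failure of the polyhedral Type-I Liouville theorem (= ¬ kill
  switch #3); `crux_implies_liouvilleFails` is the landed contrapositive.
* `PolyhedralClosing` (P_G) — §2: the complementary "closing lemma" piece of the best decomposition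
  X⁻ ⟸ E_G ∧ P_G, with the assembly `crux_of_split` PROVED and `closing_of_liouville` showing P_G is
  implied (vacuously) by the kill switch, so the whole ∃-content sits in E_G.
-/

set_option linter.dupNamespace false

namespace Summit.NavierStokesRegularity.NavierStokesRegularity.Cruxes.PolyhedralDssProfileExists.StrategistS19g4

open MeasureTheory
open Literature.Analysis.FluidPDE
open _root_.Summit.NavierStokesRegularity.NavierStokesRegularity.Theses.QuantisedSymmetry

/-- §0 (summit strength). The crux alone decides the sub-problem: both co-binders of the route's
deciding theorem `closes` are landed theorems. -/
theorem crux_decides (hX : PolyhedralDssProfileExists) : ¬ _root_.NavierStokesRegularity :=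
  closes hX
    _root_.Summit.NavierStokesRegularity.NavierStokesRegularity.Theorems.quantisedSymmetry_polyhedralTruncationBridge_proof
    ClayUniqueness_holds

/-- §1 (weaker intermediate, on-path). Landed: the crux dominates the plain Type-I DSS profile
statement of route Blowup (stmt-0155); recorded here by name only. -/
example : PolyhedralDssProfileExists →
    _root_.Summit.NavierStokesRegularity.NavierStokesRegularity.Theses.Blowup.BlowupTypeIDssProfile :=
  _root_.Summit.NavierStokesRegularity.NavierStokesRegularity.Theorems.PolyhedralDssProfileExists.PolyhedralCell.stub_dominatesBlowupProfile

/-- §1 (weaker intermediate, off-path) **E_G**: the polyhedral Type-I Liouville theorem FAILS — some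
finite irreducible proper rotation group admits a nontrivial bounded, G-equivariant, Type-I-decaying
ancient mild solution. Strictly weaker than the crux (no discrete self-similarity asked) and not
summit-deciding by any landed theorem (the general ancient truncation bridge is open). -/
def PolyhedralTypeILiouvilleFails : Prop := ¬ PolyhedralTypeILiouville

/-- Landed contrapositive of `LiouvilleKillsProfile` (#3 → ¬#2): the crux implies E_G. -/
theorem crux_implies_liouvilleFails (hX : PolyhedralDssProfileExists) :
    PolyhedralTypeILiouvilleFails :=
  fun hL =>
    _root_.Summit.NavierStokesRegularity.NavierStokesRegularity.Theorems.quantisedSymmetry_liouvilleKillsProfile_proof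
      hL hX

/-- §2 (decomposition) **P_G**, the "polyhedral closing lemma": every nontrivial bounded
G-equivariant Type-I ancient mild solution is accompanied by a nontrivial G-equivariant Type-I
`c`-DSS ancient mild solution for some `c > 1` (informally: its zoom-out hull contains a periodic
orbit of the similarity-variable flow). -/
def PolyhedralClosing : Prop :=
  ∀ G : Subgroup (EuclideanSpace ℝ (Fin 3) ≃ₗᵢ[ℝ] EuclideanSpace ℝ (Fin 3)), Finite G →
    (∀ g ∈ G, LinearMap.det (g.toLinearEquiv :
        EuclideanSpace ℝ (Fin 3) →ₗ[ℝ] EuclideanSpace ℝ (Fin 3)) = 1) →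
    (∀ V : Submodule ℝ (EuclideanSpace ℝ (Fin 3)), (∀ g ∈ G, ∀ v ∈ V, g v ∈ V) → V = ⊥ ∨ V = ⊤) →
    ∀ u : ℝ → EuclideanSpace ℝ (Fin 3) → EuclideanSpace ℝ (Fin 3),
      IsBoundedAncientMildSolution 1 u → (∀ t < 0, AEStronglyMeasurable (u t) volume) →
      (∃ C₀ : ℝ, HasTypeIDecay C₀ u) → (∀ g ∈ G, ∀ t x, u t (g x) = g (u t x)) →
      ¬ (∀ t < 0, u t =ᵐ[volume] 0) →
      ∃ c : ℝ, 1 < c ∧ ∃ v : ℝ → EuclideanSpace ℝ (Fin 3) → EuclideanSpace ℝ (Fin 3),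
        IsAncientMildSolution 1 v ∧ (∀ t < 0, AEStronglyMeasurable (v t) volume) ∧
        IsDiscretelySelfSimilar c v ∧ (∃ C₀ : ℝ, HasTypeIDecay C₀ v) ∧
        (∀ g ∈ G, ∀ t x, v t (g x) = g (v t x)) ∧ ¬ (∀ t < 0, v t =ᵐ[volume] 0)

/-- The assembly of the split is PROVED: E_G → P_G → crux. -/
theorem crux_of_split (hE : PolyhedralTypeILiouvilleFails) (hP : PolyhedralClosing) :
    PolyhedralDssProfileExists := by
  classical
  by_contra hX
  apply hE
  intro G hfin hdet hirr u hanc hmeas hdec heqv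
  by_contra hnt
  obtain ⟨c, hc, v, hv1, hv2, hv3, hv4, hv5, hv6⟩ := hP G hfin hdet hirr u hanc hmeas hdec heqv hnt
  exact hX ⟨G, hfin, hdet, hirr, c, hc, v, hv1, hv2, hv3, hv4, hv5, hv6⟩

/-- Why the split gives no leverage: P_G is implied (vacuously) by the kill switch #3, so P_G carries
no existence content — all of the `∃` sits in E_G, for which no mechanism is known. -/
theorem closing_of_liouville (hL : PolyhedralTypeILiouville) : PolyhedralClosing := by
  intro G hfin hdet hirr u hanc hmeas hdec heqv hnt
  exact absurd (hL G hfin hdet hirr u hanc hmeas hdec heqv) hnt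

/-- Conversely E_G is NECESSARY: ¬E_G (= #3) refutes the crux (landed `LiouvilleKillsProfile`). -/
theorem not_crux_of_liouville (hL : PolyhedralTypeILiouville) : ¬ PolyhedralDssProfileExists :=
  _root_.Summit.NavierStokesRegularity.NavierStokesRegularity.Theorems.quantisedSymmetry_liouvilleKillsProfile_proof hL

end Summit.NavierStokesRegularity.NavierStokesRegularity.Cruxes.PolyhedralDssProfileExists.StrategistS19g4
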